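import Mathlib
import Literature.Analysis.FluidPDE.Tao2016AveragedNS.ShiftSetCascadeFlows
import HarnessLib

/-!
# Polarisation of the cascade nonlinearity on a shift set `𝕊`: the bilinear form, scaling, and the
  EXACT blown-up deviation equation (helper for item stmt-NavierStokesRegularity-22987
  `FlatGapCertificatesV2`, crux K_A♭ of route TaoLadderRungTwoFlat; cell harvest/h2-tao-ladder, p1 g19)

`quadTermOn 𝕊 ε₀ α X` (Tao's (4.8) on a shift set) is a QUADRATIC form in the family `X`. This file records
its polarisation `bilinOn 𝕊 ε₀ α X Y` (the same triad sum with the two input slots fed by `X` and `Y`) and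
the identities every perturbative / variational statement about the lattice uses:

* `quadTermOn_eq_bilinOn` : `Q(X) = B(X, X)`;
* `bilinOn_add_left/right`, `bilinOn_smul_left/right` : bilinearity; `bilinOn_comm` : symmetry of `B`
  for tables obeying (4.2);
* `quadTermOn_add` : `Q(X + Y) = Q(X) + B(X,Y) + B(Y,X) + Q(Y)`; `quadTermOn_smul` : `Q(κX) = κ² Q(X)`;
* `quadTermOn_add_smul` : THE BLOWN-UP DEVIATION IDENTITY `Q(W + ε·η) = Q(W) + ε·(B(W,η) + B(η,W)) + ε²·Q(η)`
  — exact, no remainder: in the deviation variable `η = (X − W)/ε` the lattice is LINEAR (the variational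
  equation along `W`) plus `ε` times the same quadratic field. This is why a perturbation statement in a
  small parameter `ε` (the scale-ratio defect `ε₀` of K_A♭ after the renormalised frame of
  `…Theorems.RenormFrame`, or the distance to a reference pulse) can be enclosed UNIFORMLY down to `ε = 0`;
* `linTermOn` : the linearisation `η ↦ B(W,η) + B(η,W)` and `quadTermOn_add_eq_lin`.

HONEST FRAMING: finite algebra about a MODEL lattice nonlinearity (Tao 2016 §4 vocabulary, shift-set
parametrised); nothing is certified here and nothing is a statement about the Navier–Stokes equations.
-/

noncomputable section

-- the sub-problem namespace repeats the summit name by design (D-0017)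
set_option linter.dupNamespace false

namespace Summit.NavierStokesRegularity.NavierStokesRegularity.Theorems

open Set Literature.Analysis.FluidPDE Literature.Analysis.FluidPDE.TaoCascade

namespace QuadPolar

variable {m : ℕ}

/-- The POLARISATION of Tao's nonlinearity (4.8) on the shift set `𝕊`: the triad sum with the first input
slot fed by `X` and the second by `Y` (same clocks `(1+ε₀)^{5(n−μ₃)/2}`).
[cite: Tao2016AveragedNS, §4 (4.8); cell vocabulary, shift-set parametrised] -/
def bilinOn (𝕊 : Finset (ℤ × ℤ × ℤ)) (ε₀ : ℝ) (α : Fin m → Fin m → Fin m → ℤ × ℤ × ℤ → ℝ)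
    (X Y : Fin m → ℤ → ℝ → ℝ) (i : Fin m) (n : ℤ) (t : ℝ) : ℝ :=
  ∑ i₁ : Fin m, ∑ i₂ : Fin m, ∑ μ ∈ 𝕊,
    α i₁ i₂ i μ * (1 + ε₀) ^ ((5 : ℝ) * (n - μ.2.2) / 2) *
      (X i₁ (n - μ.2.2 + μ.1) t * Y i₂ (n - μ.2.2 + μ.2.1) t)

/-- The LINEARISATION of the nonlinearity at the family `W`: `η ↦ B(W, η) + B(η, W)`.
[cite: Tao2016AveragedNS, §4 (4.8); cell vocabulary, shift-set parametrised] -/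
def linTermOn (𝕊 : Finset (ℤ × ℤ × ℤ)) (ε₀ : ℝ) (α : Fin m → Fin m → Fin m → ℤ × ℤ × ℤ → ℝ)
    (W η : Fin m → ℤ → ℝ → ℝ) (i : Fin m) (n : ℤ) (t : ℝ) : ℝ :=
  bilinOn 𝕊 ε₀ α W η i n t + bilinOn 𝕊 ε₀ α η W i n t

/-- `Q(X) = B(X, X)`. [cite: Tao2016AveragedNS, §4 (4.8)] -/
theorem quadTermOn_eq_bilinOn (𝕊 : Finset (ℤ × ℤ × ℤ)) (ε₀ : ℝ)
    (α : Fin m → Fin m → Fin m → ℤ × ℤ × ℤ → ℝ) (X : Fin m → ℤ → ℝ → ℝ) (i : Fin m) (n : ℤ) (t : ℝ) :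
    quadTermOn 𝕊 ε₀ α X i n t = bilinOn 𝕊 ε₀ α X X i n t := rfl

/-- Additivity of `B` in the first slot. [cite: Tao2016AveragedNS, §4 (4.8)] -/
theorem bilinOn_add_left (𝕊 : Finset (ℤ × ℤ × ℤ)) (ε₀ : ℝ)
    (α : Fin m → Fin m → Fin m → ℤ × ℤ × ℤ → ℝ) (X X' Y : Fin m → ℤ → ℝ → ℝ) (i : Fin m) (n : ℤ)
    (t : ℝ) :
    bilinOn 𝕊 ε₀ α (X + X') Y i n t = bilinOn 𝕊 ε₀ α X Y i n t + bilinOn 𝕊 ε₀ α X' Y i n t := by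
  simp only [bilinOn, Pi.add_apply, ← Finset.sum_add_distrib]
  refine Finset.sum_congr rfl fun _ _ => Finset.sum_congr rfl fun _ _ => Finset.sum_congr rfl fun _ _ => ?_
  ring

/-- Additivity of `B` in the second slot. [cite: Tao2016AveragedNS, §4 (4.8)] -/
theorem bilinOn_add_right (𝕊 : Finset (ℤ × ℤ × ℤ)) (ε₀ : ℝ)
    (α : Fin m → Fin m → Fin m → ℤ × ℤ × ℤ → ℝ) (X Y Y' : Fin m → ℤ → ℝ → ℝ) (i : Fin m) (n : ℤ)
    (t : ℝ) :
    bilinOn 𝕊 ε₀ α X (Y + Y') i n t = bilinOn 𝕊 ε₀ α X Y i n t + bilinOn 𝕊 ε₀ α X Y' i n t := by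
  simp only [bilinOn, Pi.add_apply, ← Finset.sum_add_distrib]
  refine Finset.sum_congr rfl fun _ _ => Finset.sum_congr rfl fun _ _ => Finset.sum_congr rfl fun _ _ => ?_
  ring

/-- Homogeneity of `B` in the first slot. [cite: Tao2016AveragedNS, §4 (4.8)] -/
theorem bilinOn_smul_left (𝕊 : Finset (ℤ × ℤ × ℤ)) (ε₀ : ℝ)
    (α : Fin m → Fin m → Fin m → ℤ × ℤ × ℤ → ℝ) (κ : ℝ) (X Y : Fin m → ℤ → ℝ → ℝ) (i : Fin m)
    (n : ℤ) (t : ℝ) :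
    bilinOn 𝕊 ε₀ α (κ • X) Y i n t = κ * bilinOn 𝕊 ε₀ α X Y i n t := by
  simp only [bilinOn, Pi.smul_apply, smul_eq_mul, Finset.mul_sum]
  refine Finset.sum_congr rfl fun _ _ => Finset.sum_congr rfl fun _ _ => Finset.sum_congr rfl fun _ _ => ?_
  ring

/-- Homogeneity of `B` in the second slot. [cite: Tao2016AveragedNS, §4 (4.8)] -/
theorem bilinOn_smul_right (𝕊 : Finset (ℤ × ℤ × ℤ)) (ε₀ : ℝ)
    (α : Fin m → Fin m → Fin m → ℤ × ℤ × ℤ → ℝ) (κ : ℝ) (X Y : Fin m → ℤ → ℝ → ℝ) (i : Fin m)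
    (n : ℤ) (t : ℝ) :
    bilinOn 𝕊 ε₀ α X (κ • Y) i n t = κ * bilinOn 𝕊 ε₀ α X Y i n t := by
  simp only [bilinOn, Pi.smul_apply, smul_eq_mul, Finset.mul_sum]
  refine Finset.sum_congr rfl fun _ _ => Finset.sum_congr rfl fun _ _ => Finset.sum_congr rfl fun _ _ => ?_
  ring

/-- **Symmetry of the polarisation** for tables obeying (4.2) on `𝕊` when `𝕊` is closed under swapping the
two input shifts: `B(X, Y) = B(Y, X)`. [cite: Tao2016AveragedNS, §4 (4.2), (4.8)] -/
theorem bilinOn_comm {𝕊 : Finset (ℤ × ℤ × ℤ)} (hswap : ∀ μ ∈ 𝕊, (μ.2.1, μ.1, μ.2.2) ∈ 𝕊) (ε₀ : ℝ)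
    {α : Fin m → Fin m → Fin m → ℤ × ℤ × ℤ → ℝ} (hα : IsSymmetricCoeffOn 𝕊 α)
    (X Y : Fin m → ℤ → ℝ → ℝ) (i : Fin m) (n : ℤ) (t : ℝ) :
    bilinOn 𝕊 ε₀ α X Y i n t = bilinOn 𝕊 ε₀ α Y X i n t := by
  unfold bilinOn
  rw [Finset.sum_comm]
  refine Finset.sum_congr rfl fun i₂ _ => Finset.sum_congr rfl fun i₁ _ => ?_
  -- reindex the shift sum by the swap involution `(μ₁, μ₂, μ₃) ↦ (μ₂, μ₁, μ₃)`
  refine Finset.sum_nbij' (fun μ => (μ.2.1, μ.1, μ.2.2)) (fun μ => (μ.2.1, μ.1, μ.2.2))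
    (fun μ hμ => hswap μ hμ) (fun μ hμ => hswap μ hμ) (fun μ _ => rfl) (fun μ _ => rfl) ?_
  intro μ hμ
  obtain ⟨μ₁, μ₂, μ₃⟩ := μ
  have hs := hα i₁ i₂ i μ₁ μ₂ μ₃ hμ
  simp only
  rw [hs]
  ring

/-- **`Q(X + Y) = Q(X) + B(X,Y) + B(Y,X) + Q(Y)`.** [cite: Tao2016AveragedNS, §4 (4.8)] -/
theorem quadTermOn_add (𝕊 : Finset (ℤ × ℤ × ℤ)) (ε₀ : ℝ)
    (α : Fin m → Fin m → Fin m → ℤ × ℤ × ℤ → ℝ) (X Y : Fin m → ℤ → ℝ → ℝ) (i : Fin m) (n : ℤ) (t : ℝ) :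
    quadTermOn 𝕊 ε₀ α (X + Y) i n t =
      quadTermOn 𝕊 ε₀ α X i n t + bilinOn 𝕊 ε₀ α X Y i n t + bilinOn 𝕊 ε₀ α Y X i n t +
        quadTermOn 𝕊 ε₀ α Y i n t := by
  rw [quadTermOn_eq_bilinOn, quadTermOn_eq_bilinOn, quadTermOn_eq_bilinOn, bilinOn_add_left,
    bilinOn_add_right, bilinOn_add_right]
  ring

/-- **`Q(κX) = κ² Q(X)`** (the amplitude scaling of the quadratic lattice). [cite: Tao2016AveragedNS, §4 (4.8)] -/
theorem quadTermOn_smul (𝕊 : Finset (ℤ × ℤ × ℤ)) (ε₀ : ℝ)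
    (α : Fin m → Fin m → Fin m → ℤ × ℤ × ℤ → ℝ) (κ : ℝ) (X : Fin m → ℤ → ℝ → ℝ) (i : Fin m) (n : ℤ)
    (t : ℝ) :
    quadTermOn 𝕊 ε₀ α (κ • X) i n t = κ ^ 2 * quadTermOn 𝕊 ε₀ α X i n t := by
  rw [quadTermOn_eq_bilinOn, quadTermOn_eq_bilinOn, bilinOn_smul_left, bilinOn_smul_right]
  ring

/-- `Q(X + Y) = Q(X) + Lin_X(Y) + Q(Y)` with the linearisation `linTermOn`.
[cite: Tao2016AveragedNS, §4 (4.8)] -/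
theorem quadTermOn_add_eq_lin (𝕊 : Finset (ℤ × ℤ × ℤ)) (ε₀ : ℝ)
    (α : Fin m → Fin m → Fin m → ℤ × ℤ × ℤ → ℝ) (W η : Fin m → ℤ → ℝ → ℝ) (i : Fin m) (n : ℤ) (t : ℝ) :
    quadTermOn 𝕊 ε₀ α (W + η) i n t =
      quadTermOn 𝕊 ε₀ α W i n t + linTermOn 𝕊 ε₀ α W η i n t + quadTermOn 𝕊 ε₀ α η i n t := by
  rw [quadTermOn_add, linTermOn]
  ring

/-- The linearisation is additive. [cite: Tao2016AveragedNS, §4 (4.8)] -/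
theorem linTermOn_add (𝕊 : Finset (ℤ × ℤ × ℤ)) (ε₀ : ℝ)
    (α : Fin m → Fin m → Fin m → ℤ × ℤ × ℤ → ℝ) (W η η' : Fin m → ℤ → ℝ → ℝ) (i : Fin m) (n : ℤ)
    (t : ℝ) :
    linTermOn 𝕊 ε₀ α W (η + η') i n t = linTermOn 𝕊 ε₀ α W η i n t + linTermOn 𝕊 ε₀ α W η' i n t := by
  simp only [linTermOn, bilinOn_add_left, bilinOn_add_right]
  ring

/-- The linearisation is homogeneous. [cite: Tao2016AveragedNS, §4 (4.8)] -/
theorem linTermOn_smul (𝕊 : Finset (ℤ × ℤ × ℤ)) (ε₀ : ℝ)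
    (α : Fin m → Fin m → Fin m → ℤ × ℤ × ℤ → ℝ) (W : Fin m → ℤ → ℝ → ℝ) (κ : ℝ)
    (η : Fin m → ℤ → ℝ → ℝ) (i : Fin m) (n : ℤ) (t : ℝ) :
    linTermOn 𝕊 ε₀ α W (κ • η) i n t = κ * linTermOn 𝕊 ε₀ α W η i n t := by
  simp only [linTermOn, bilinOn_smul_left, bilinOn_smul_right]
  ring

/-- For symmetric tables (4.2) on a swap-closed shift set the linearisation is `2·B(W, η)`.
[cite: Tao2016AveragedNS, §4 (4.2), (4.8)] -/
theorem linTermOn_eq_two_mul {𝕊 : Finset (ℤ × ℤ × ℤ)} (hswap : ∀ μ ∈ 𝕊, (μ.2.1, μ.1, μ.2.2) ∈ 𝕊)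
    (ε₀ : ℝ) {α : Fin m → Fin m → Fin m → ℤ × ℤ × ℤ → ℝ} (hα : IsSymmetricCoeffOn 𝕊 α)
    (W η : Fin m → ℤ → ℝ → ℝ) (i : Fin m) (n : ℤ) (t : ℝ) :
    linTermOn 𝕊 ε₀ α W η i n t = 2 * bilinOn 𝕊 ε₀ α W η i n t := by
  rw [linTermOn, bilinOn_comm hswap ε₀ hα η W]
  ring

/-- **THE BLOWN-UP DEVIATION IDENTITY.** `Q(W + ε·η) = Q(W) + ε·Lin_W(η) + ε²·Q(η)` — exact. So along a
reference family `W` the deviation `η := (X − W)/ε` of another family `X` obeys a LINEAR equation plus `ε`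
times the same quadratic field, uniformly down to `ε = 0`.
[cite: Tao2016AveragedNS, §4 (4.8); cell harvest/h2-tao-ladder, blown-up coordinates] -/
theorem quadTermOn_add_smul (𝕊 : Finset (ℤ × ℤ × ℤ)) (ε₀ : ℝ)
    (α : Fin m → Fin m → Fin m → ℤ × ℤ × ℤ → ℝ) (W η : Fin m → ℤ → ℝ → ℝ) (ε : ℝ) (i : Fin m) (n : ℤ)
    (t : ℝ) :
    quadTermOn 𝕊 ε₀ α (W + ε • η) i n t =
      quadTermOn 𝕊 ε₀ α W i n t + ε * linTermOn 𝕊 ε₀ α W η i n t + ε ^ 2 * quadTermOn 𝕊 ε₀ α η i n t := by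
  rw [quadTermOn_add_eq_lin, linTermOn_smul, quadTermOn_smul]

/-- The deviation form: if `X = W + ε·η` pointwise then `(Q(X) − Q(W)) = ε·(Lin_W(η) + ε·Q(η))`.
[cite: Tao2016AveragedNS, §4 (4.8); cell harvest/h2-tao-ladder, blown-up coordinates] -/
theorem quadTermOn_sub_of_deviation (𝕊 : Finset (ℤ × ℤ × ℤ)) (ε₀ : ℝ)
    (α : Fin m → Fin m → Fin m → ℤ × ℤ × ℤ → ℝ) {W η X : Fin m → ℤ → ℝ → ℝ} {ε : ℝ}
    (hX : X = W + ε • η) (i : Fin m) (n : ℤ) (t : ℝ) :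
    quadTermOn 𝕊 ε₀ α X i n t - quadTermOn 𝕊 ε₀ α W i n t =
      ε * (linTermOn 𝕊 ε₀ α W η i n t + ε * quadTermOn 𝕊 ε₀ α η i n t) := by
  rw [hX, quadTermOn_add_smul]
  ring

/-- Both shift sets of the cell are swap-closed: Tao's `S`. [cite: Tao2016AveragedNS, §4 after (4.1)] -/
theorem swap_mem_shiftSet : ∀ μ ∈ shiftSet, (μ.2.1, μ.1, μ.2.2) ∈ shiftSet := by
  decide

/-- Both shift sets of the cell are swap-closed: `S♭`. [cite: Tao2016AveragedNS, §4 after (4.1); cell vocabulary] -/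
theorem swap_mem_shiftSetFlat : ∀ μ ∈ shiftSetFlat, (μ.2.1, μ.1, μ.2.2) ∈ shiftSetFlat := by
  decide

end QuadPolar

end Summit.NavierStokesRegularity.NavierStokesRegularity.Theorems

end
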